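import Literature.NumberTheory.Sieve.BombieriFriedlanderIwaniecTheorem7StarSwitchPadic
import Literature.NumberTheory.Sieve.BombieriFriedlanderIwaniecTheorem7StarSwitchHarmonic
import HarnessLib

/-!
# Bombieri–Friedlander–Iwaniec 1986, Theorem 7* (§14): the main terms of the `q ↔ s` switch

Topic `Literature/NumberTheory/Sieve`; continuation of `…Theorem7StarSwitchPadic` (the exact
switch and the `p`-adic reduction) and `…Theorem7StarSwitchHarmonic` (windows of `∑ 1/φ(rn)`).
Everything here is PROVED; no named fact is introduced.

For a block `q ∈ (Q', 2Q']` of `Δ*` at `(r, l)`, the term that `Δ*` subtracts is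
`B(r,l) = ∑_{q, (q,al)=1} φ(qr)⁻¹ #ρρ{(m,n) : (mn, qr) = 1}`, while the switched counts of
`…SwitchPadic` come with the model weights `P_a(lmn; d r s)` (`BFI.pmodel`), i.e. with the
expected term `B^{sw}(r,l) = ∑_{d ∣ |a|} μ(d) ∑_{s ≤ S} ∑_{m,n} ρρ [window] P_a(lmn; d r s)`.
BFI §13 p. 241–242 ("since both `q` and `s` are counted with weight 1 they appear symmetrically …
since `s ∼ S = x/QR > ℒ^B`, this lower bound being crucial") is made quantitative here: PER `(m, n)`
(`k = lmn`, `K = k − a ≥ 1`) both expected terms are sums of the same function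
`f(n) = [(n, |a|k) = 1]/φ(rn)` over windows of ratio `2` — `(Q', 2Q']` for `B` (`Borig_term_eq`) and,
after grouping `s` by its `|a|`-part `g` (`Bsw_term_eq`), `((K−1)/(2Q'rg), (K−1)/(Q'rg)]` weighted
by `P_a(k; dg)` for `B^{sw}` — and `∑_{d ∣ |a|} μ(d) ∑_g P_a(k; dg) = 1` EXACTLY
(`sum_moebius_sum_divisors_eq`, Möbius inversion once more).  With the window comparison of
`…SwitchHarmonic` this gives `|B^{sw} − B| ≤ ∑_{m,n} C(a, S) τ(|a|lmn) Φ (Q'r/(lmn − a) + 1/Q')/φ(r)`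
(`abs_Bsw_sub_Borig_le`), i.e. a saving `1/S + 1/Q'` relative to the trivial size.

## References

* E. Bombieri, J. B. Friedlander, H. Iwaniec, *Primes in arithmetic progressions to large moduli*,
  Acta Math. 156 (1986), 203–251: §13 p. 241–242, §14 p. 246. [BombieriFriedlanderIwaniecActa1986]
-/

noncomputable section

open Finset Real

open scoped ArithmeticFunction.sigma ArithmeticFunction.Moebius

namespace Literature.NumberTheory.Sieve

namespace BFI

/-! ### Bounds for the model weight -/

/-- `P_a(k; w) ≤ 1`. [folklore] -/
theorem pmodel_le_one (a : ℤ) (k w : ℕ) : pmodel a k w ≤ 1 := by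
  unfold pmodel
  split_ifs with h
  · rcases Nat.eq_zero_or_pos (Nat.totient (w / Nat.gcd a.natAbs w)) with h0 | h0
    · rw [h0]; simp
    · have : (1 : ℝ) ≤ (Nat.totient (w / Nat.gcd a.natAbs w) : ℕ) := by exact_mod_cast h0
      exact inv_le_one_of_one_le₀ this
  · norm_num

/-- `φ(p^j) ≥ p^j / 2` for a prime `p`. [folklore] -/
theorem pow_le_two_mul_totient_prime_pow {p : ℕ} (hp : p.Prime) (j : ℕ) :
    (p : ℝ) ^ j ≤ 2 * Nat.totient (p ^ j) := by
  rcases Nat.eq_zero_or_pos j with hj | hj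
  · subst hj; simp
  · rw [Nat.totient_prime_pow hp hj]
    have hp2 : (2 : ℝ) ≤ p := by exact_mod_cast hp.two_le
    have e : (p : ℝ) ^ j = (p : ℝ) ^ (j - 1) * p := by rw [← pow_succ]; congr 1; omega
    push_cast
    rw [Nat.cast_sub hp.one_le, Nat.cast_one, e]
    have : (0 : ℝ) ≤ (p : ℝ) ^ (j - 1) := by positivity
    nlinarith

/-- **`P_a(k; p^j) ≤ 2 p^{v_p(a)}/p^j`** (`a, k ≠ 0`). [folklore] -/
theorem pmodel_prime_pow_le {p : ℕ} (hp : p.Prime) {a : ℤ} (ha : a ≠ 0) {k : ℕ} (hk : k ≠ 0) (j : ℕ) :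
    pmodel a k (p ^ j) ≤ 2 * (p : ℝ) ^ padicValNat p a.natAbs / (p : ℝ) ^ j := by
  haveI := Fact.mk hp
  set α := padicValNat p a.natAbs with hα
  have hp0 : (0 : ℝ) < p := by exact_mod_cast hp.pos
  have hpj : (0 : ℝ) < (p : ℝ) ^ j := by positivity
  rw [le_div_iff₀ hpj]
  rcases le_or_gt j α with hjα | hjα
  · -- `j ≤ α`: `P ≤ 1 ≤ 2 p^α/p^j`
    calc pmodel a k (p ^ j) * (p : ℝ) ^ j ≤ 1 * (p : ℝ) ^ j :=
          mul_le_mul_of_nonneg_right (pmodel_le_one _ _ _) hpj.le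
      _ ≤ 1 * (p : ℝ) ^ α := by rw [one_mul, one_mul]; exact pow_le_pow_right₀ (by exact_mod_cast hp.one_le) hjα
      _ ≤ 2 * (p : ℝ) ^ α := by gcongr; norm_num
  · -- `j > α`: `P ≤ 1/φ(p^{j−α}) ≤ 2/p^{j−α}`
    rw [pmodel_prime_pow_of_lt hp ha hjα hk]
    have hφ := pow_le_two_mul_totient_prime_pow hp (j - α)
    have hφpos : (0 : ℝ) < Nat.totient (p ^ (j - α)) := by
      exact_mod_cast Nat.totient_pos.2 (pow_pos hp.pos _)
    have e : (p : ℝ) ^ j = (p : ℝ) ^ (j - α) * (p : ℝ) ^ α := by rw [← pow_add]; congr 1; omega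
    split_ifs
    · rw [e, ← mul_assoc]
      refine mul_le_mul_of_nonneg_right ?_ (by positivity)
      rw [inv_mul_le_iff₀ hφpos]
      linarith
    · rw [zero_mul]; positivity

/-- **`P_a(k; w) ≤ (∏_{p ∣ w} 2 p^{v_p(a)})/w`** for `w ≥ 1` (`a, k ≠ 0`), by multiplicativity. [folklore] -/
theorem pmodel_le_prod_div {a : ℤ} (ha : a ≠ 0) {k : ℕ} (hk : k ≠ 0) :
    ∀ w : ℕ, 0 < w → pmodel a k w ≤
      (∏ p ∈ w.primeFactors, (2 * (p : ℝ) ^ padicValNat p a.natAbs)) / w := by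
  intro w
  induction w using Nat.recOnPosPrimePosCoprime with
  | prime_pow p n hp hn =>
    intro _
    rw [Nat.primeFactors_prime_pow hn.ne' hp, Finset.prod_singleton, Nat.cast_pow]
    exact pmodel_prime_pow_le hp ha hk n
  | zero => intro h; exact absurd h (lt_irrefl 0)
  | one =>
    intro _
    rw [Nat.primeFactors_one, Finset.prod_empty, Nat.cast_one, div_one]
    exact pmodel_le_one _ _ _
  | coprime m n hm hn hmn ihm ihn =>
    intro _
    have hm0 : 0 < m := by omega
    have hn0 : 0 < n := by omega
    rw [pmodel_mul_of_coprime a k hmn, Nat.Coprime.primeFactors_mul hmn,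
      Finset.prod_union hmn.disjoint_primeFactors, Nat.cast_mul, mul_div_mul_comm]
    exact mul_le_mul (ihm hm0) (ihn hn0) (pmodel_nonneg _ _ _)
      (div_nonneg (Finset.prod_nonneg fun _ _ => by positivity) (by positivity))

/-- The amplitude `2^{ω(|a|)} |a|` of the model weights. [folklore] -/
def pAmp (a : ℤ) : ℝ := 2 ^ a.natAbs.primeFactors.card * (a.natAbs : ℝ)

/-- `pAmp a ≥ 1` for `a ≠ 0`. [folklore] -/
theorem one_le_pAmp {a : ℤ} (ha : a ≠ 0) : 1 ≤ pAmp a := by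
  unfold pAmp
  have h1 : (1 : ℝ) ≤ 2 ^ a.natAbs.primeFactors.card := one_le_pow₀ (by norm_num)
  have h2 : (1 : ℝ) ≤ a.natAbs := by exact_mod_cast Int.natAbs_pos.2 ha
  nlinarith

/-- **`P_a(k; w) ≤ 2^{ω(|a|)} |a| / w`** when every prime of `w` divides `a` (`w ≥ 1`, `a, k ≠ 0`).
[folklore] -/
theorem pmodel_le_pAmp_div {a : ℤ} (ha : a ≠ 0) {k : ℕ} (hk : k ≠ 0) {w : ℕ} (hw : 0 < w)
    (hsub : w.primeFactors ⊆ a.natAbs.primeFactors) : pmodel a k w ≤ pAmp a / w := by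
  refine (pmodel_le_prod_div ha hk w hw).trans (div_le_div_of_nonneg_right ?_ (by positivity))
  have hA : a.natAbs ≠ 0 := Int.natAbs_ne_zero.2 ha
  have hone : ∀ p ∈ a.natAbs.primeFactors, (1 : ℝ) ≤ 2 * (p : ℝ) ^ padicValNat p a.natAbs := by
    intro p hp
    have : (1 : ℝ) ≤ (p : ℝ) ^ padicValNat p a.natAbs :=
      one_le_pow₀ (by exact_mod_cast (Nat.prime_of_mem_primeFactors hp).one_le)
    linarith
  calc ∏ p ∈ w.primeFactors, (2 * (p : ℝ) ^ padicValNat p a.natAbs)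
      ≤ ∏ p ∈ a.natAbs.primeFactors, (2 * (p : ℝ) ^ padicValNat p a.natAbs) := by
        rw [← Finset.prod_sdiff hsub]
        refine le_mul_of_one_le_left (Finset.prod_nonneg fun _ _ => by positivity) ?_
        exact Finset.prod_induction _ (fun x : ℝ => 1 ≤ x)
          (fun x y hx hy => one_le_mul_of_one_le_of_one_le hx hy) le_rfl
          (fun p hp => hone p (Finset.sdiff_subset hp))
    _ = 2 ^ a.natAbs.primeFactors.card * ∏ p ∈ a.natAbs.primeFactors, (p : ℝ) ^ padicValNat p a.natAbs := by
        rw [Finset.prod_mul_distrib, Finset.prod_const]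
    _ = pAmp a := by
        unfold pAmp
        congr 1
        have hcast : ((∏ p ∈ a.natAbs.primeFactors, p ^ a.natAbs.factorization p : ℕ) : ℝ) = (a.natAbs : ℝ) := by
          rw [← Nat.prod_primeFactors_pow_factorization hA]
        rw [← hcast, Nat.cast_prod]
        refine Finset.prod_congr rfl fun p hp => ?_
        rw [Nat.cast_pow, Nat.factorization_def _ (Nat.prime_of_mem_primeFactors hp)]

/-! ### Möbius over `d ∣ |a|` against divisors of `Θ`: the main terms agree exactly -/

/-- **`∑_{d ∣ A} μ(d) ∑_{g ∣ Θ, dg ∣ Θ} F(dg) = F(1)`** when every prime of `Θ` divides `A`: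
regrouping by `w = dg ∣ Θ`, the inner Möbius sum is `[(w, A) = 1] = [w = 1]`. [folklore] -/
theorem sum_moebius_sum_divisors_eq {A Θ : ℕ} (hA : A ≠ 0) (hΘ : Θ ≠ 0)
    (hsub : Θ.primeFactors ⊆ A.primeFactors) (F : ℕ → ℝ) :
    ∑ d ∈ A.divisors, (μ d : ℝ) * ∑ g ∈ Θ.divisors.filter (fun g => d * g ∣ Θ), F (d * g) = F 1 := by
  -- reindex the inner sum by `w = d g`
  have step1 : ∀ d ∈ A.divisors, ∑ g ∈ Θ.divisors.filter (fun g => d * g ∣ Θ), F (d * g) =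
      ∑ w ∈ Θ.divisors, (if d ∣ w then F w else 0) := by
    intro d hd
    have hd0 : 0 < d := Nat.pos_of_mem_divisors hd
    rw [← Finset.sum_filter]
    have himg : Θ.divisors.filter (fun w => d ∣ w) =
        (Θ.divisors.filter (fun g => d * g ∣ Θ)).image (fun g => d * g) := by
      ext w
      simp only [Finset.mem_filter, Finset.mem_image, Nat.mem_divisors]
      constructor
      · rintro ⟨⟨hw, -⟩, g, rfl⟩
        exact ⟨g, ⟨⟨(dvd_mul_left g d).trans hw, hΘ⟩, hw⟩, rfl⟩
      · rintro ⟨g, ⟨-, hdg⟩, rfl⟩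
        exact ⟨⟨hdg, hΘ⟩, dvd_mul_right d g⟩
    rw [himg, Finset.sum_image (fun x _ y _ h => Nat.eq_of_mul_eq_mul_left hd0 h)]
  rw [Finset.sum_congr rfl fun d hd => by rw [step1 d hd]]
  -- swap and evaluate the Möbius sum
  have step2 : ∑ d ∈ A.divisors, (μ d : ℝ) * ∑ w ∈ Θ.divisors, (if d ∣ w then F w else 0) =
      ∑ w ∈ Θ.divisors, F w * ∑ d ∈ A.divisors.filter (fun d => d ∣ w), (μ d : ℝ) := by
    simp_rw [Finset.mul_sum]
    rw [Finset.sum_comm]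
    refine Finset.sum_congr rfl fun w _ => ?_
    rw [Finset.sum_filter]
    refine Finset.sum_congr rfl fun d _ => ?_
    split_ifs <;> ring
  rw [step2]
  have step3 : ∀ w ∈ Θ.divisors, F w * ∑ d ∈ A.divisors.filter (fun d => d ∣ w), (μ d : ℝ) =
      if w = 1 then F 1 else 0 := by
    intro w hw
    have hw0 : w ≠ 0 := (Nat.pos_of_mem_divisors hw).ne'
    rw [← coprime_indicator_eq_sum_moebius hw0 hA]
    by_cases h1 : w = 1
    · subst h1; simp
    · rw [if_neg h1, if_neg, mul_zero]
      intro hcop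
      obtain ⟨p, hp, hpw⟩ := Nat.exists_prime_and_dvd h1
      have hpΘ : p ∈ Θ.primeFactors :=
        Nat.mem_primeFactors.2 ⟨hp, hpw.trans (Nat.dvd_of_mem_divisors hw), hΘ⟩
      have hpA : p ∣ A := Nat.dvd_of_mem_primeFactors (hsub hpΘ)
      exact (Nat.Prime.one_lt hp).ne' (Nat.eq_one_of_dvd_one (hcop ▸ Nat.dvd_gcd hpw hpA))
  rw [Finset.sum_congr rfl step3, Finset.sum_ite_eq' , if_pos (Nat.one_mem_divisors.2 hΘ)]

/-! ### The unswitched expected term of a `q`-block -/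

/-- `B(r,l)` for the block `q ∈ (Q', 2Q']`: `∑_{q, (q,al)=1} φ(qr)⁻¹ #ρρ{(m,n) : (mn,qr)=1}` — the
term `Δ*` subtracts (`BFI.setQSum` = `A − B`). [cite: BombieriFriedlanderIwaniecActa1986, §14 p. 244] -/
def Borig (a : ℤ) (z : ℝ) (SM SN : Finset ℕ) (l r Q' : ℕ) : ℝ :=
  ∑ q ∈ (Ioc Q' (2 * Q')).filter (fun q : ℕ => IsCoprime (q : ℤ) (a * l)),
    setCoprimeCount z SM SN (q * r) / (Nat.totient (q * r) : ℝ)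

/-- The unswitched expected term per `k = lmn`: `[(k, r) = 1] · W(Q', 2Q')` with `W = BFI.phiWin`
at the coprimality parameter `|a| k`. [folklore] -/
def e1fun (a : ℤ) (r Q' k : ℕ) : ℝ :=
  if k.Coprime r then phiWin r (a.natAbs * k) Q' (2 * Q') else 0

/-- The coprimality bookkeeping of `Borig_eq`: for `q ≥ 1`, `(l, r) = 1`,
`(q, al) = 1 ∧ (mn, qr) = 1 ⇔ (lmn, r) = 1 ∧ (q, |a| lmn) = 1`. [folklore] -/
theorem isCoprime_and_coprime_iff {a : ℤ} {q l r m n : ℕ} (hlr : l.Coprime r) :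
    (IsCoprime (q : ℤ) (a * l) ∧ (m * n).Coprime (q * r)) ↔
      ((l * m * n).Coprime r ∧ q.Coprime (a.natAbs * (l * m * n))) := by
  have e1 : IsCoprime (q : ℤ) (a * l) ↔ q.Coprime (a.natAbs * l) := by
    rw [Int.isCoprime_iff_nat_coprime, Int.natAbs_natCast, Int.natAbs_mul, Int.natAbs_natCast]
  rw [e1]
  constructor
  · rintro ⟨hq, hmn⟩
    obtain ⟨hqA, hql⟩ := Nat.coprime_mul_iff_right.1 hq
    obtain ⟨hmnq, hmnr⟩ := Nat.coprime_mul_iff_right.1 hmn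
    obtain ⟨hmq, hnq⟩ := Nat.coprime_mul_iff_left.1 hmnq
    obtain ⟨hmr, hnr⟩ := Nat.coprime_mul_iff_left.1 hmnr
    exact ⟨Nat.Coprime.mul_left (Nat.Coprime.mul_left hlr hmr) hnr,
      Nat.Coprime.mul_right hqA (Nat.Coprime.mul_right (Nat.Coprime.mul_right hql hmq.symm) hnq.symm)⟩
  · rintro ⟨hk, hq⟩
    obtain ⟨hqA, hqlmn⟩ := Nat.coprime_mul_iff_right.1 hq
    obtain ⟨hqlm, hqn⟩ := Nat.coprime_mul_iff_right.1 hqlmn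
    obtain ⟨hql, hqm⟩ := Nat.coprime_mul_iff_right.1 hqlm
    obtain ⟨hlmr, hnr⟩ := Nat.coprime_mul_iff_left.1 hk
    obtain ⟨-, hmr⟩ := Nat.coprime_mul_iff_left.1 hlmr
    exact ⟨Nat.Coprime.mul_right hqA hql,
      Nat.Coprime.mul_right (Nat.Coprime.mul_left hqm.symm hqn.symm) (Nat.Coprime.mul_left hmr hnr)⟩

/-- **`B(r,l) = ∑_{m,n} ρ(m)ρ(n) e₁(lmn)`** (for `(l, r) = 1`). [folklore] -/
theorem Borig_eq (a : ℤ) (z : ℝ) (SM SN : Finset ℕ) {l r : ℕ} (hlr : l.Coprime r) (Q' : ℕ) :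
    Borig a z SM SN l r Q' =
      ∑ m ∈ SM, ∑ n ∈ SN, roughIndicator z m * roughIndicator z n * e1fun a r Q' (l * m * n) := by
  unfold Borig setCoprimeCount e1fun phiWin
  -- write the `q`-sum with an indicator and move it inside
  rw [Finset.sum_filter]
  have step : ∀ q ∈ Ioc Q' (2 * Q'),
      (if IsCoprime (q : ℤ) (a * l) then
        (∑ m ∈ SM, ∑ n ∈ SN, if (m * n).Coprime (q * r) then roughIndicator z m * roughIndicator z n else 0) /
          (Nat.totient (q * r) : ℝ) else 0) =
      ∑ m ∈ SM, ∑ n ∈ SN, roughIndicator z m * roughIndicator z n *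
        (if (l * m * n).Coprime r ∧ q.Coprime (a.natAbs * (l * m * n)) then
          (1 : ℝ) / Nat.totient (r * q) else 0) := by
    intro q _
    rw [mul_comm r q]
    by_cases hq : IsCoprime (q : ℤ) (a * l)
    · rw [if_pos hq, Finset.sum_div]
      refine Finset.sum_congr rfl fun m _ => ?_
      rw [Finset.sum_div]
      refine Finset.sum_congr rfl fun n _ => ?_
      have hiff := isCoprime_and_coprime_iff (a := a) (q := q) (m := m) (n := n) hlr
      by_cases h : (m * n).Coprime (q * r)
      · rw [if_pos h, if_pos (hiff.1 ⟨hq, h⟩)]; ring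
      · rw [if_neg h, if_neg (fun h' => h (hiff.2 h').2), zero_div, mul_zero]
    · rw [if_neg hq]; symm
      refine Finset.sum_eq_zero fun m _ => Finset.sum_eq_zero fun n _ => ?_
      rw [if_neg, mul_zero]
      intro h'
      exact hq ((isCoprime_and_coprime_iff (a := a) (q := q) (m := m) (n := n) hlr).2 h').1
  rw [Finset.sum_congr rfl step, Finset.sum_comm]
  refine Finset.sum_congr rfl fun m _ => ?_
  rw [Finset.sum_comm]
  refine Finset.sum_congr rfl fun n _ => ?_
  rw [← Finset.mul_sum]
  congr 1
  by_cases hkr : (l * m * n).Coprime r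
  · rw [if_pos hkr, Finset.sum_filter]
    refine Finset.sum_congr rfl fun q _ => ?_
    by_cases hq : q.Coprime (a.natAbs * (l * m * n))
    · rw [if_pos ⟨hkr, hq⟩, if_pos hq]
    · rw [if_neg (fun h => hq h.2), if_neg hq]
  · rw [if_neg hkr]
    exact Finset.sum_eq_zero fun q _ => by rw [if_neg (fun h => hkr h.1)]

/-! ### The switched expected term of a `q`-block -/

/-- `B^{sw}(r,l)`: the expected values attached to the switched counts of
`BFI.sum_filter_coprime_setCongrCount_eq_moebius_switch`. [folklore] -/
def Bsw (a : ℤ) (z : ℝ) (SM SN : Finset ℕ) (l r Q' S : ℕ) : ℝ :=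
  ∑ d ∈ a.natAbs.divisors, (μ d : ℝ) *
    ∑ s ∈ Icc 1 S, gmodel a z SM SN l l (d * (r * s)) (a + (Q' : ℤ) * r * s) (a + 2 * (Q' : ℤ) * r * s)

/-- The switched expected term per `k = lmn`:
`e₂(k) = ∑_{d ∣ |a|} μ(d) ∑_{s ≤ S} [Q'rs < k − a ≤ 2Q'rs] P_a(k; d r s)`. [folklore] -/
def e2fun (a : ℤ) (r Q' S k : ℕ) : ℝ :=
  ∑ d ∈ a.natAbs.divisors, (μ d : ℝ) *
    ∑ s ∈ Icc 1 S, wind (a + (Q' : ℤ) * r * s) (a + 2 * (Q' : ℤ) * r * s) k * pmodel a k (d * (r * s))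

/-- **`B^{sw}(r,l) = ∑_{m,n} ρ(m)ρ(n) e₂(lmn)`**. [folklore] -/
theorem Bsw_eq (a : ℤ) (z : ℝ) (SM SN : Finset ℕ) (l r Q' S : ℕ) :
    Bsw a z SM SN l r Q' S =
      ∑ m ∈ SM, ∑ n ∈ SN, roughIndicator z m * roughIndicator z n * e2fun a r Q' S (l * m * n) := by
  unfold Bsw e2fun gmodel
  -- both sides are finite sums; bring `m, n` outside
  have h1 : ∀ d ∈ a.natAbs.divisors, (μ d : ℝ) * ∑ s ∈ Icc 1 S, ∑ m ∈ SM, ∑ n ∈ SN,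
      pmodel a (l * m * n) (d * (r * s)) * wind (a + (Q' : ℤ) * r * s) (a + 2 * (Q' : ℤ) * r * s) (l * m * n) *
        (roughIndicator z m * roughIndicator z n) =
      ∑ m ∈ SM, ∑ n ∈ SN, roughIndicator z m * roughIndicator z n * ((μ d : ℝ) * ∑ s ∈ Icc 1 S,
        wind (a + (Q' : ℤ) * r * s) (a + 2 * (Q' : ℤ) * r * s) (l * m * n) * pmodel a (l * m * n) (d * (r * s))) := by
    intro d _
    rw [Finset.sum_comm, Finset.mul_sum]
    refine Finset.sum_congr rfl fun m _ => ?_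
    rw [Finset.sum_comm, Finset.mul_sum]
    refine Finset.sum_congr rfl fun n _ => ?_
    rw [Finset.mul_sum, Finset.mul_sum, Finset.mul_sum]
    refine Finset.sum_congr rfl fun s _ => ?_
    ring
  rw [Finset.sum_congr rfl h1, Finset.sum_comm]
  refine Finset.sum_congr rfl fun m _ => ?_
  rw [Finset.sum_comm]
  refine Finset.sum_congr rfl fun n _ => ?_
  rw [Finset.mul_sum]

/-! ### The switched expected term per `k`: grouping `s` by its `|a|`-part -/

/-- The window of the switched count in terms of `s₂ = s/g`: for `K = k − a ≥ 1` and
`D = Q' r g ≥ 1`, `[Q'r(gs₂) < k − a ≤ 2Q'r(gs₂)] = [s₂ ∈ ((K−1)/(2D), (K−1)/D]]`. [folklore] -/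
theorem wind_switch_eq {a : ℤ} {k K : ℕ} (hK : (k : ℤ) - a = K) (hK1 : 1 ≤ K) {Q' r g : ℕ}
    (hD : 0 < Q' * r * g) (s₂ : ℕ) :
    wind (a + (Q' : ℤ) * r * ((g * s₂ : ℕ) : ℤ)) (a + 2 * (Q' : ℤ) * r * ((g * s₂ : ℕ) : ℤ)) k =
      if s₂ ∈ Ioc ((K - 1) / (2 * (Q' * r * g))) ((K - 1) / (Q' * r * g)) then 1 else 0 := by
  unfold wind
  have h1 : (a + (Q' : ℤ) * r * ((g * s₂ : ℕ) : ℤ) < (k : ℤ)) ↔ (Q' * r * g * s₂ < K) := by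
    constructor
    · intro h
      have : ((Q' * r * g * s₂ : ℕ) : ℤ) < (K : ℤ) := by push_cast at h ⊢; linarith
      exact_mod_cast this
    · intro h
      have : ((Q' * r * g * s₂ : ℕ) : ℤ) < (K : ℤ) := by exact_mod_cast h
      push_cast at this ⊢; linarith
  have h2 : ((k : ℤ) ≤ a + 2 * (Q' : ℤ) * r * ((g * s₂ : ℕ) : ℤ)) ↔ (K ≤ 2 * (Q' * r * g) * s₂) := by
    constructor
    · intro h
      have : ((K : ℕ) : ℤ) ≤ ((2 * (Q' * r * g) * s₂ : ℕ) : ℤ) := by push_cast at h ⊢; linarith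
      exact_mod_cast this
    · intro h
      have : ((K : ℕ) : ℤ) ≤ ((2 * (Q' * r * g) * s₂ : ℕ) : ℤ) := by exact_mod_cast h
      push_cast at this ⊢; linarith
  have h3 : (Q' * r * g * s₂ < K ∧ K ≤ 2 * (Q' * r * g) * s₂) ↔
      s₂ ∈ Ioc ((K - 1) / (2 * (Q' * r * g))) ((K - 1) / (Q' * r * g)) := by
    rw [Finset.mem_Ioc, Nat.div_lt_iff_lt_mul (by positivity), Nat.le_div_iff_mul_le hD]
    constructor
    · rintro ⟨hl, hr⟩; constructor
      · have : K - 1 < 2 * (Q' * r * g) * s₂ := by omega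
        linarith [mul_comm s₂ (2 * (Q' * r * g))]
      · have : Q' * r * g * s₂ ≤ K - 1 := by omega
        linarith [mul_comm s₂ (Q' * r * g)]
    · rintro ⟨hl, hr⟩; constructor
      · have : s₂ * (Q' * r * g) ≤ K - 1 := hr
        have := mul_comm s₂ (Q' * r * g); omega
      · have : K - 1 < s₂ * (2 * (Q' * r * g)) := hl
        have := mul_comm s₂ (2 * (Q' * r * g)); omega
  simp only [h1, h2]
  by_cases h : Q' * r * g * s₂ < K ∧ K ≤ 2 * (Q' * r * g) * s₂
  · rw [if_pos h, if_pos (h3.1 h)]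
  · rw [if_neg h, if_neg (fun h' => h (h3.2 h'))]

/-- If `0 < g ∣ A^N` and `g < 2^N` (`N ≥ 1`) then already `g ∣ A^{N−1}`. [folklore] -/
theorem dvd_pow_pred_of_lt {A N g : ℕ} (hN : 1 ≤ N) (h0 : 0 < g) (hg : g ∣ A ^ N) (hlt : g < 2 ^ N) :
    g ∣ A ^ (N - 1) := by
  rw [Nat.dvd_iff_prime_pow_dvd_dvd]
  intro p j hp hpj
  rcases Nat.eq_zero_or_pos j with hj | hj
  · subst hj; simp
  -- `p ∣ A` and `j ≤ N − 1`
  have hpg : p ∣ g := (dvd_pow_self p hj.ne').trans hpj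
  have hpA : p ∣ A := hp.dvd_of_dvd_pow (hpg.trans hg)
  have hjN : j ≤ N - 1 := by
    by_contra hcon
    have hNj : N ≤ j := by omega
    have : 2 ^ N ≤ g := by
      calc 2 ^ N ≤ p ^ N := Nat.pow_le_pow_left hp.two_le N
        _ ≤ p ^ j := Nat.pow_le_pow_right hp.pos hNj
        _ ≤ g := Nat.le_of_dvd h0 hpj
    omega
  exact (pow_dvd_pow p hjN).trans (pow_dvd_pow_of_dvd hpA _)

/-- The inner `s₂`-sum of the switched expected term at fixed `d ∣ |a|`, `g ∣ Θ = |a|^N`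
(`N = log₂ S + 1`): `= P_a(k; dg) · [(k,r)=1] · W((K−1)/(2Q'rg), (K−1)/(Q'rg))`. [folklore] -/
theorem e2_inner_eq {a : ℤ} (ha : a ≠ 0) {r : ℕ} (hr : 0 < r) (hrA : r.Coprime a.natAbs) {Q' : ℕ}
    (hQ' : 0 < Q') {S : ℕ} {k K : ℕ} (hK : (k : ℤ) - a = K) (hK1 : 1 ≤ K) (hKS : K ≤ S)
    {d : ℕ} (hd : d ∈ a.natAbs.divisors) {g : ℕ} (hg : g ∈ (a.natAbs ^ (Nat.log 2 S + 1)).divisors) :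
    ∑ s₂ ∈ (Icc 1 (S / g)).filter (fun s₂ : ℕ => s₂.Coprime (a.natAbs ^ (Nat.log 2 S + 1) / g)),
        wind (a + (Q' : ℤ) * r * ((g * s₂ : ℕ) : ℤ)) (a + 2 * (Q' : ℤ) * r * ((g * s₂ : ℕ) : ℤ)) k *
          pmodel a k (d * (r * (g * s₂))) =
      pmodel a k (d * g) * (if k.Coprime r then
        phiWin r (a.natAbs * k) ((K - 1) / (2 * (Q' * r * g))) ((K - 1) / (Q' * r * g)) else 0) := by
  set A := a.natAbs with hA
  set N := Nat.log 2 S + 1 with hN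
  have hA0 : A ≠ 0 := Int.natAbs_ne_zero.2 ha
  have hA1 : 0 < A := Nat.pos_of_ne_zero hA0
  have hN1 : 1 ≤ N := by omega
  have hΘ0 : A ^ N ≠ 0 := pow_ne_zero _ hA0
  have hd0 : 0 < d := Nat.pos_of_mem_divisors hd
  have hdA : d ∣ A := Nat.dvd_of_mem_divisors hd
  have hg0 : 0 < g := Nat.pos_of_mem_divisors hg
  have hgΘ : g ∣ A ^ N := Nat.dvd_of_mem_divisors hg
  have hD : 0 < Q' * r * g := by positivity
  have hS2 : S < 2 ^ N := Nat.lt_pow_succ_log_self (by norm_num) S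
  set U := (K - 1) / (2 * (Q' * r * g)) with hU
  set V := (K - 1) / (Q' * r * g) with hV
  by_cases hgS : S < g
  · -- `g > S`: both sides vanish
    have hSg : S / g = 0 := Nat.div_eq_of_lt hgS
    have hV0 : V = 0 := by
      rw [hV]; apply Nat.div_eq_of_lt
      calc K - 1 < g := by omega
        _ ≤ Q' * r * g := Nat.le_mul_of_pos_left g (by positivity)
    rw [hSg]
    simp only [show Icc 1 0 = (∅ : Finset ℕ) by rfl, Finset.filter_empty, Finset.sum_empty]
    rw [hV0]
    unfold phiWin
    simp
  push Not at hgS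
  -- `g ≤ S`: `g ∣ A^{N−1}`, so `A ∣ Θ/g` and `dg ∣ Θ`
  have hgN : g ∣ A ^ (N - 1) := dvd_pow_pred_of_lt hN1 hg0 hgΘ (lt_of_le_of_lt hgS hS2)
  obtain ⟨t, ht⟩ := hgN
  have hΘg : A ^ N / g = A * t := by
    have : A ^ N = g * (A * t) := by
      calc A ^ N = A * A ^ (N - 1) := by rw [← pow_succ', Nat.sub_add_cancel hN1]
        _ = g * (A * t) := by rw [ht]; ring
    rw [this, Nat.mul_div_cancel_left _ hg0]
  -- the filter `(s₂, Θ/g) = 1` is `(s₂, A) = 1`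
  have hfilt : ∀ s₂ : ℕ, s₂.Coprime (A ^ N / g) ↔ s₂.Coprime A := by
    intro s₂
    rw [hΘg]
    constructor
    · intro h; exact Nat.Coprime.coprime_dvd_right (dvd_mul_right A t) h
    · intro h
      have hAN : s₂.Coprime (A ^ N) := Nat.Coprime.pow_right N h
      refine Nat.Coprime.coprime_dvd_right ?_ hAN
      rw [← hΘg]; exact Nat.div_dvd_of_dvd hgΘ
  -- the summand for `s₂ ≥ 1` coprime to `A`
  have hterm : ∀ s₂ : ℕ, 0 < s₂ → s₂.Coprime A →
      wind (a + (Q' : ℤ) * r * ((g * s₂ : ℕ) : ℤ)) (a + 2 * (Q' : ℤ) * r * ((g * s₂ : ℕ) : ℤ)) k *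
        pmodel a k (d * (r * (g * s₂))) =
      (if s₂ ∈ Ioc U V then 1 else 0) * (pmodel a k (d * g) *
        (if k.Coprime r ∧ k.Coprime s₂ then (1 : ℝ) / Nat.totient (r * s₂) else 0)) := by
    intro s₂ hs₂ hs₂A
    rw [wind_switch_eq hK hK1 hD s₂, ← hU, ← hV]
    congr 1
    have hrs : (r * s₂).Coprime A := Nat.Coprime.mul_left hrA hs₂A
    have hdg : d * g ∣ A ^ (N + 1) := by
      rw [pow_succ']; exact mul_dvd_mul hdA hgΘ
    have hcop : (d * g).Coprime (r * s₂) :=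
      (Nat.Coprime.coprime_dvd_right hdg (Nat.Coprime.pow_right (N + 1) hrs)).symm
    rw [show d * (r * (g * s₂)) = (d * g) * (r * s₂) by ring, pmodel_mul_of_coprime a k hcop,
      pmodel_of_coprime hrs.symm]
    congr 1
    have : k.Coprime (r * s₂) ↔ k.Coprime r ∧ k.Coprime s₂ := Nat.coprime_mul_iff_right
    simp only [this]
    split_ifs <;> simp
  -- rewrite the sum
  have hsum1 : ∑ s₂ ∈ (Icc 1 (S / g)).filter (fun s₂ : ℕ => s₂.Coprime (A ^ N / g)),
      wind (a + (Q' : ℤ) * r * ((g * s₂ : ℕ) : ℤ)) (a + 2 * (Q' : ℤ) * r * ((g * s₂ : ℕ) : ℤ)) k *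
        pmodel a k (d * (r * (g * s₂))) =
      ∑ s₂ ∈ Icc 1 (S / g), (if s₂.Coprime A then
        (if s₂ ∈ Ioc U V then 1 else 0) * (pmodel a k (d * g) *
          (if k.Coprime r ∧ k.Coprime s₂ then (1 : ℝ) / Nat.totient (r * s₂) else 0)) else 0) := by
    rw [Finset.sum_filter]
    refine Finset.sum_congr rfl fun s₂ hs₂ => ?_
    simp only [hfilt]
    by_cases h : s₂.Coprime A
    · rw [if_pos h, if_pos h]; exact hterm s₂ (Finset.mem_Icc.1 hs₂).1 h
    · rw [if_neg h, if_neg h]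
  rw [hsum1]
  -- `Ioc U V ⊆ Icc 1 (S/g)`
  have hVS : V ≤ S / g := by
    calc V ≤ (K - 1) / g := Nat.div_le_div_left (Nat.le_mul_of_pos_left g (by positivity)) hg0
      _ ≤ S / g := Nat.div_le_div_right (by omega)
  have hsub : Ioc U V ⊆ Icc 1 (S / g) := by
    intro s hs
    rw [Finset.mem_Ioc] at hs
    rw [Finset.mem_Icc]
    exact ⟨Nat.lt_of_le_of_lt (Nat.zero_le U) hs.1, hs.2.trans hVS⟩
  rw [← Finset.sum_subset hsub (fun s₂ _ hs₂ => by
    by_cases h1 : s₂.Coprime A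
    · rw [if_pos h1, if_neg hs₂, zero_mul]
    · rw [if_neg h1])]
  -- now both sides are sums over `Ioc U V`
  by_cases hkr : k.Coprime r
  · rw [if_pos hkr]
    unfold phiWin
    rw [Finset.sum_filter, Finset.mul_sum]
    refine Finset.sum_congr rfl fun s₂ hs₂ => ?_
    have hcopAk : s₂.Coprime (A * k) ↔ s₂.Coprime A ∧ k.Coprime s₂ := by
      rw [Nat.coprime_mul_iff_right]
      exact ⟨fun h => ⟨h.1, h.2.symm⟩, fun h => ⟨h.1, h.2.symm⟩⟩
    simp only [hcopAk]
    by_cases h1 : s₂.Coprime A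
    · rw [if_pos h1, if_pos hs₂, one_mul]
      congr 1
      by_cases h2 : k.Coprime s₂
      · rw [if_pos ⟨hkr, h2⟩, if_pos ⟨h1, h2⟩]
      · rw [if_neg (fun h => h2 h.2), if_neg (fun h => h2 h.2)]
    · rw [if_neg h1, if_neg (fun h => h1 h.1), mul_zero]
  · rw [if_neg hkr, mul_zero]
    refine Finset.sum_eq_zero fun s₂ _ => ?_
    by_cases h1 : s₂.Coprime A
    · rw [if_pos h1, if_neg (show ¬(k.Coprime r ∧ k.Coprime s₂) from fun h => hkr h.1), mul_zero, mul_zero]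
    · rw [if_neg h1]

/-- **`e₂(k) = ∑_{d ∣ |a|} μ(d) ∑_{g ∣ Θ} P_a(k; dg) · [(k,r)=1] W((K−1)/(2Q'rg), (K−1)/(Q'rg))`**,
`Θ = |a|^{log₂ S + 1}` (grouping `s ≤ S` by `g = (s, Θ)`, which is the full `|a|`-part of `s`).
[cite: BombieriFriedlanderIwaniecActa1986, §13 p. 241–242] -/
theorem e2fun_eq {a : ℤ} (ha : a ≠ 0) {r : ℕ} (hr : 0 < r) (hrA : r.Coprime a.natAbs) {Q' : ℕ}
    (hQ' : 0 < Q') {S : ℕ} {k K : ℕ} (hK : (k : ℤ) - a = K) (hK1 : 1 ≤ K) (hKS : K ≤ S) :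
    e2fun a r Q' S k =
      ∑ d ∈ a.natAbs.divisors, (μ d : ℝ) * ∑ g ∈ (a.natAbs ^ (Nat.log 2 S + 1)).divisors,
        pmodel a k (d * g) * (if k.Coprime r then
          phiWin r (a.natAbs * k) ((K - 1) / (2 * (Q' * r * g))) ((K - 1) / (Q' * r * g)) else 0) := by
  have hA0 : a.natAbs ≠ 0 := Int.natAbs_ne_zero.2 ha
  have hΘ : 0 < a.natAbs ^ (Nat.log 2 S + 1) := pow_pos (Nat.pos_of_ne_zero hA0) _
  unfold e2fun
  refine Finset.sum_congr rfl fun d hd => ?_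
  congr 1
  rw [sum_Icc_eq_sum_divisors_gcd hΘ S]
  refine Finset.sum_congr rfl fun g hg => ?_
  exact e2_inner_eq ha hr hrA hQ' hK hK1 hKS hd hg

/-! ### The per-`k` comparison of the two expected terms -/

/-- `P_a(k; 1) = 1`. [folklore] -/
theorem pmodel_one (a : ℤ) (k : ℕ) : pmodel a k 1 = 1 := by
  unfold pmodel; simp

/-- The error weight of the main-term comparison:
`200 · 2^{ω(|a|)} |a| · τ(|a|) · τ(|a|^{log₂ S + 1})`. [folklore] -/
def merrConst (a : ℤ) (S : ℕ) : ℝ :=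
  200 * pAmp a * (σ 0 a.natAbs : ℝ) * (σ 0 (a.natAbs ^ (Nat.log 2 S + 1)) : ℝ)

/-- `merrConst ≥ 0`. [folklore] -/
theorem merrConst_nonneg (a : ℤ) (S : ℕ) : 0 ≤ merrConst a S := by
  unfold merrConst pAmp; positivity

/-- `(dg)`'s primes divide `a` for `d ∣ |a|`, `g ∣ |a|^N`. [folklore] -/
theorem primeFactors_mul_subset {a : ℤ} (ha : a ≠ 0) {d g N : ℕ} (hd : d ∣ a.natAbs) (hg : g ∣ a.natAbs ^ N) :
    (d * g).primeFactors ⊆ a.natAbs.primeFactors := by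
  have hA0 : a.natAbs ≠ 0 := Int.natAbs_ne_zero.2 ha
  have h : d * g ∣ a.natAbs ^ (N + 1) := by rw [pow_succ']; exact mul_dvd_mul hd hg
  calc (d * g).primeFactors ⊆ (a.natAbs ^ (N + 1)).primeFactors := Nat.primeFactors_mono h (pow_ne_zero _ hA0)
    _ = a.natAbs.primeFactors := Nat.primeFactors_pow _ (by omega)

set_option maxHeartbeats 800000 in
/-- **The weighted window comparison for one pair `(d, g)`**: for `d ∣ |a|`, `g ∣ Θ`,
`P_a(k; dg) · |W(U_g, V_g) − W(Q', 2Q')| ≤ 200 · 2^{ω}|a| · τ(|a|k) · Φ(S+2Q') · (Q'r/K + 1/Q')/φ(r)`,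
`U_g = (K−1)/(2Q'rg)`, `V_g = (K−1)/(Q'rg)`: the weight is `≤ 2^ω|a|/g` while the windows differ by
`O(Φ τ (1/U_g + 1/Q')/φ(r))` with `1/U_g ≤ 4Q'rg/K` (and for `U_g = 0` one has `1/g ≤ 2Q'r/K`).
[cite: BombieriFriedlanderIwaniecActa1986, §13 p. 241–242] -/
theorem pmodel_mul_abs_phiWin_sub_le {a : ℤ} (ha : a ≠ 0) {r : ℕ} (hr : 0 < r) {Q' : ℕ} (hQ' : 0 < Q')
    {S : ℕ} {k K : ℕ} (hK1 : 1 ≤ K) (hKS : K ≤ S) (hk : k ≠ 0)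
    {d : ℕ} (hd : d ∈ a.natAbs.divisors) {g : ℕ} (hg : g ∈ (a.natAbs ^ (Nat.log 2 S + 1)).divisors) :
    pmodel a k (d * g) *
        |phiWin r (a.natAbs * k) ((K - 1) / (2 * (Q' * r * g))) ((K - 1) / (Q' * r * g)) -
          phiWin r (a.natAbs * k) Q' (2 * Q')| ≤
      200 * pAmp a * (σ 0 (a.natAbs * k) : ℝ) * totInvSum (S + 2 * Q') *
        ((Q' * r : ℝ) / K + 1 / Q') / Nat.totient r := by
  set A := a.natAbs with hA
  have hA0 : A ≠ 0 := Int.natAbs_ne_zero.2 ha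
  have hd0 : 0 < d := Nat.pos_of_mem_divisors hd
  have hg0 : 0 < g := Nat.pos_of_mem_divisors hg
  have hdA : d ∣ A := Nat.dvd_of_mem_divisors hd
  have hgΘ : g ∣ A ^ (Nat.log 2 S + 1) := Nat.dvd_of_mem_divisors hg
  have hφr : (0 : ℝ) < Nat.totient r := by exact_mod_cast Nat.totient_pos.2 hr
  have hAk : A * k ≠ 0 := mul_ne_zero hA0 hk
  have hσ1 : (1 : ℝ) ≤ σ 0 (A * k) := by exact_mod_cast one_le_sigma_zero hAk
  have hpA : 1 ≤ pAmp a := one_le_pAmp ha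
  have hK0 : (0 : ℝ) < K := by exact_mod_cast hK1
  have hQ0 : (0 : ℝ) < Q' := by exact_mod_cast hQ'
  have hg0' : (0 : ℝ) < g := by exact_mod_cast hg0
  set D := Q' * r * g with hDdef
  have hD : 0 < D := by positivity
  have hD' : (0 : ℝ) < D := by exact_mod_cast hD
  set U := (K - 1) / (2 * D) with hUdef
  set V := (K - 1) / D with hVdef
  set Φ₀ := totInvSum (S + 2 * Q') with hΦ₀
  have hΦ₀0 : 0 ≤ Φ₀ := totInvSum_nonneg _
  set Wg := phiWin r (A * k) U V with hWg
  set WQ := phiWin r (A * k) Q' (2 * Q') with hWQ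
  -- the weight
  have hP : pmodel a k (d * g) ≤ pAmp a / g := by
    have h1 := pmodel_le_pAmp_div ha hk (Nat.mul_pos hd0 hg0) (primeFactors_mul_subset ha hdA hgΘ)
    refine h1.trans ?_
    rw [Nat.cast_mul]
    exact div_le_div_of_nonneg_left (by linarith) hg0' (le_mul_of_one_le_left hg0'.le (by exact_mod_cast hd0))
  have hP0 : 0 ≤ pmodel a k (d * g) := pmodel_nonneg _ _ _
  -- sizes of the windows
  have hVK : V ≤ K - 1 := Nat.div_le_self _ _
  have hWg_le : Wg ≤ Φ₀ / Nat.totient r :=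
    (phiWin_le hr _ _ _).trans (div_le_div_of_nonneg_right (totInvSum_mono (V' := S + 2 * Q') (by omega)) hφr.le)
  have hWQ_le : WQ ≤ Φ₀ / Nat.totient r :=
    (phiWin_le hr _ _ _).trans (div_le_div_of_nonneg_right (totInvSum_mono (V' := S + 2 * Q') (by omega)) hφr.le)
  have hWg0 : 0 ≤ Wg := phiWin_nonneg _ _ _ _
  have hWQ0 : 0 ≤ WQ := phiWin_nonneg _ _ _ _
  -- the target, and a convenient intermediate form
  set T := 200 * pAmp a * (σ 0 (A * k) : ℝ) * Φ₀ * ((Q' * r : ℝ) / K + 1 / Q') / Nat.totient r with hT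
  have hTform : ∀ c₁ c₂ : ℝ, 0 ≤ c₁ → c₁ ≤ 200 → 0 ≤ c₂ → c₂ ≤ 200 →
      pAmp a * (σ 0 (A * k) : ℝ) * Φ₀ / Nat.totient r * (c₁ * (Q' * r) / K + c₂ / Q') ≤ T := by
    intro c₁ c₂ h1 h1' h2 h2'
    rw [hT]
    have hbase : 0 ≤ pAmp a * (σ 0 (A * k) : ℝ) * Φ₀ / Nat.totient r := by positivity
    have hx : 0 ≤ (Q' * r : ℝ) / K := by positivity
    have hy : (0 : ℝ) ≤ 1 / Q' := by positivity
    calc pAmp a * (σ 0 (A * k) : ℝ) * Φ₀ / Nat.totient r * (c₁ * (Q' * r) / K + c₂ / Q')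
        = pAmp a * (σ 0 (A * k) : ℝ) * Φ₀ / Nat.totient r * (c₁ * ((Q' * r : ℝ) / K) + c₂ * (1 / Q')) := by
          ring
      _ ≤ pAmp a * (σ 0 (A * k) : ℝ) * Φ₀ / Nat.totient r * (200 * ((Q' * r : ℝ) / K) + 200 * (1 / Q')) := by
          refine mul_le_mul_of_nonneg_left ?_ hbase
          nlinarith
      _ = 200 * pAmp a * (σ 0 (A * k) : ℝ) * Φ₀ * ((Q' * r : ℝ) / K + 1 / Q') / Nat.totient r := by ring
  by_cases hU1 : 1 ≤ U
  · -- the main case: both windows are genuine, compare them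
    have h2DK : 2 * D ≤ K - 1 := by
      rw [hUdef, Nat.le_div_iff_mul_le (by positivity)] at hU1; omega
    have hUV' : U = V / 2 := by
      rw [hUdef, hVdef, Nat.div_div_eq_div_mul, mul_comm D 2]
    have hV2 : V = 2 * U + V % 2 := by rw [hUV']; exact (Nat.div_add_mod V 2).symm
    have hmod : V % 2 ≤ 1 := Nat.lt_succ_iff.1 (Nat.mod_lt V (by norm_num))
    have hUV : U ≤ V := by omega
    have hV3 : V ≤ 3 * U := by omega
    have hQ12 : Q' ≤ 2 * Q' := by omega
    have hQ23 : 2 * Q' ≤ 3 * Q' := by omega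
    have hwin := abs_phiWin_sub_phiWin_le (k := A * k) hr hAk hU1 hUV hV3 hQ' hQ12 hQ23
    rw [← hWg, ← hWQ] at hwin
    -- the logarithms differ by at most `1/U`
    have hU0 : (0 : ℝ) < U := by exact_mod_cast hU1
    have hlog : |Real.log ((V : ℝ) / U) - Real.log (((2 * Q' : ℕ) : ℝ) / Q')| ≤ 1 / U := by
      have e2 : ((2 * Q' : ℕ) : ℝ) / Q' = 2 := by push_cast; field_simp
      set b := V % 2 with hb
      have hb1 : (b : ℝ) ≤ 1 := by exact_mod_cast hmod
      have hb0 : (0 : ℝ) ≤ b := by positivity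
      have eV : (V : ℝ) / U = 2 * (1 + b / (2 * U)) := by
        rw [hV2]; push_cast; field_simp
      have hy : 1 ≤ 1 + (b : ℝ) / (2 * U) := by
        have : 0 ≤ (b : ℝ) / (2 * U) := by positivity
        linarith
      rw [e2, eV, Real.log_mul (by norm_num) (by positivity), add_sub_cancel_left,
        abs_of_nonneg (Real.log_nonneg hy)]
      calc Real.log (1 + (b : ℝ) / (2 * U)) ≤ (1 + (b : ℝ) / (2 * U)) - 1 :=
            Real.log_le_sub_one_of_pos (by positivity)
        _ = (b : ℝ) / (2 * U) := by ring
        _ ≤ 1 / U := by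
            rw [div_le_div_iff₀ (by positivity) hU0]; nlinarith
    have hmax : totInvSum (max V (2 * Q')) ≤ Φ₀ := by
      rw [hΦ₀]; exact totInvSum_mono (V' := S + 2 * Q') (by omega)
    -- `|Wg − WQ| ≤ (Φ₀/φr) · 25 τ · (1/U + 1/Q')`
    have hΔ : |Wg - WQ| ≤ Φ₀ / Nat.totient r * (25 * (σ 0 (A * k) : ℝ) * (1 / U + 1 / Q')) := by
      refine hwin.trans ?_
      have hX : 0 ≤ 1 / (U : ℝ) + 1 / Q' := by positivity
      have hQinv : (0 : ℝ) ≤ 1 / Q' := by positivity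
      have h1 : |Real.log ((V : ℝ) / U) - Real.log (((2 * Q' : ℕ) : ℝ) / Q')| +
          24 * (σ 0 (A * k) : ℝ) * (1 / U + 1 / Q') ≤ 25 * (σ 0 (A * k) : ℝ) * (1 / U + 1 / Q') := by
        have h2 : (1 : ℝ) / U ≤ (σ 0 (A * k) : ℝ) * (1 / U + 1 / Q') := by
          have h3 : (1 : ℝ) / U ≤ 1 * (1 / U + 1 / Q') := by linarith
          exact h3.trans (mul_le_mul_of_nonneg_right hσ1 hX)
        linarith
      exact mul_le_mul (div_le_div_of_nonneg_right hmax hφr.le) h1 (by positivity) (by positivity)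
    -- `1/U ≤ 4D/K`
    have hUK : 1 / (U : ℝ) ≤ 4 * D / K := by
      have hlt : K - 1 < (K - 1) / (2 * D) * (2 * D) + 2 * D := Nat.lt_div_mul_add (by positivity)
      have e1 : (K - 1) / (2 * D) * (2 * D) = 2 * (D * U) := by rw [← hUdef]; ring
      rw [e1] at hlt
      have hDP : D ≤ D * U := Nat.le_mul_of_pos_right D hU1
      have hK4 : K ≤ 4 * (D * U) := by omega
      have hK4' : (K : ℝ) ≤ 4 * ((D : ℝ) * U) := by exact_mod_cast hK4
      rw [div_le_div_iff₀ hU0 hK0]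
      linarith
    have hΔ' : |Wg - WQ| ≤ Φ₀ / Nat.totient r * (25 * (σ 0 (A * k) : ℝ) * (4 * D / K + 1 / Q')) :=
      hΔ.trans (by gcongr)
    have e : (pAmp a / g) * (Φ₀ / Nat.totient r * (25 * (σ 0 (A * k) : ℝ) * (4 * D / K + 1 / Q'))) =
        pAmp a * (σ 0 (A * k) : ℝ) * Φ₀ / Nat.totient r * (100 * (Q' * r) / K + (25 / g) / Q') := by
      rw [hDdef]; push_cast; field_simp; ring
    have c1 : (0 : ℝ) ≤ 100 := by norm_num
    have c2 : (100 : ℝ) ≤ 200 := by norm_num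
    have c3 : (0 : ℝ) ≤ 25 / g := by positivity
    have c4 : (25 : ℝ) / g ≤ 200 := by
      have hg1 : (1 : ℝ) ≤ g := by exact_mod_cast hg0
      exact (div_le_self (by norm_num) hg1).trans (by norm_num)
    calc pmodel a k (d * g) * |Wg - WQ|
        ≤ (pAmp a / g) * (Φ₀ / Nat.totient r * (25 * (σ 0 (A * k) : ℝ) * (4 * D / K + 1 / Q'))) :=
          mul_le_mul hP hΔ' (abs_nonneg _) (by positivity)
      _ = pAmp a * (σ 0 (A * k) : ℝ) * Φ₀ / Nat.totient r * (100 * (Q' * r) / K + (25 / g) / Q') := e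
      _ ≤ T := hTform 100 (25 / g) c1 c2 c3 c4
  · -- the degenerate case `U = 0`: `K ≤ 2 Q' r g`, both windows are trivially bounded
    push Not at hU1
    have hU0 : U = 0 := Nat.lt_one_iff.mp hU1
    have hKD : K ≤ 2 * D := by
      have : K - 1 < 2 * D := by
        rw [hUdef] at hU0
        rwa [Nat.div_eq_zero_iff_lt (by positivity)] at hU0
      omega
    have hKD' : (K : ℝ) ≤ 2 * D := by exact_mod_cast hKD
    have hginv : (1 : ℝ) / g ≤ 2 * (Q' * r) / K := by
      rw [div_le_div_iff₀ hg0' hK0, one_mul, hDdef] at *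
      push_cast at hKD' ⊢
      linarith
    have hΔ : |Wg - WQ| ≤ 2 * (Φ₀ / Nat.totient r) := by
      rw [abs_le]; constructor <;> linarith
    calc pmodel a k (d * g) * |Wg - WQ| ≤ (pAmp a / g) * (2 * (Φ₀ / Nat.totient r)) :=
          mul_le_mul hP hΔ (abs_nonneg _) (by positivity)
      _ = pAmp a * Φ₀ / Nat.totient r * 2 * (1 / g) := by ring
      _ ≤ pAmp a * Φ₀ / Nat.totient r * 2 * (2 * (Q' * r) / K) :=
          mul_le_mul_of_nonneg_left hginv (by positivity)
      _ ≤ pAmp a * (σ 0 (A * k) : ℝ) * Φ₀ / Nat.totient r * (4 * (Q' * r) / K + 0 / Q') := by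
          rw [zero_div, add_zero]
          have : pAmp a * Φ₀ / Nat.totient r * 2 * (2 * (Q' * r) / K) =
              pAmp a * 1 * Φ₀ / Nat.totient r * (4 * (Q' * r) / K) := by ring
          rw [this]
          gcongr
      _ ≤ T := by
          have c1 : (0 : ℝ) ≤ 4 := by norm_num
          have c2 : (4 : ℝ) ≤ 200 := by norm_num
          have c4 : (0 : ℝ) ≤ 200 := by norm_num
          exact hTform 4 0 c1 c2 le_rfl c4

/-- If `d ∣ |a|`, `g ∣ Θ = |a|^N` (`N = log₂ S + 1`) but `dg ∤ Θ`, then `g > S`, so the switched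
window `((K−1)/(2Q'rg), (K−1)/(Q'rg)]` is empty. [folklore] -/
theorem div_eq_zero_of_not_dvd {a : ℤ} {S K : ℕ} (hKS : K ≤ S) {Q' r : ℕ} (hQr : 0 < Q' * r)
    {d : ℕ} (hd : d ∈ a.natAbs.divisors) {g : ℕ} (hg : g ∈ (a.natAbs ^ (Nat.log 2 S + 1)).divisors)
    (hndvd : ¬ d * g ∣ a.natAbs ^ (Nat.log 2 S + 1)) : (K - 1) / (Q' * r * g) = 0 := by
  set N := Nat.log 2 S + 1 with hN
  have hg0 : 0 < g := Nat.pos_of_mem_divisors hg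
  have hgΘ : g ∣ a.natAbs ^ N := Nat.dvd_of_mem_divisors hg
  have hdA : d ∣ a.natAbs := Nat.dvd_of_mem_divisors hd
  have hSg : S < g := by
    by_contra hle
    push Not at hle
    have hS2 : S < 2 ^ N := Nat.lt_pow_succ_log_self (by norm_num) S
    have hgN : g ∣ a.natAbs ^ (N - 1) := dvd_pow_pred_of_lt (by omega) hg0 hgΘ (lt_of_le_of_lt hle hS2)
    apply hndvd
    have : a.natAbs ^ N = a.natAbs * a.natAbs ^ (N - 1) := by
      rw [← pow_succ', Nat.sub_add_cancel (show 1 ≤ N by omega)]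
    rw [this]
    exact mul_dvd_mul hdA hgN
  apply Nat.div_eq_of_lt
  calc K - 1 < g := by omega
    _ ≤ Q' * r * g := Nat.le_mul_of_pos_left g hQr

/-- **The two expected terms agree per `k` up to `O(τ Φ (Q'r/K + 1/Q')/φ(r))`**: for `a ≠ 0`,
`r ≥ 1` coprime to `a`, `Q' ≥ 1`, `k = a + K` with `1 ≤ K ≤ S`,
`|e₂(k) − e₁(k)| ≤ merrConst(a,S) τ(|a|k) Φ(S+2Q') (Q'r/K + 1/Q')/φ(r)`.
[cite: BombieriFriedlanderIwaniecActa1986, §13 p. 241–242] -/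
theorem abs_e2fun_sub_e1fun_le {a : ℤ} (ha : a ≠ 0) {r : ℕ} (hr : 0 < r) (hrA : r.Coprime a.natAbs)
    {Q' : ℕ} (hQ' : 0 < Q') {S : ℕ} {k K : ℕ} (hK : (k : ℤ) - a = K) (hK1 : 1 ≤ K) (hKS : K ≤ S)
    (hk : k ≠ 0) :
    |e2fun a r Q' S k - e1fun a r Q' k| ≤
      merrConst a S * (σ 0 (a.natAbs * k) : ℝ) * totInvSum (S + 2 * Q') *
        ((Q' * r : ℝ) / K + 1 / Q') / Nat.totient r := by
  set A := a.natAbs with hA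
  set N := Nat.log 2 S + 1 with hN
  set Θ := A ^ N with hΘ
  have hA0 : A ≠ 0 := Int.natAbs_ne_zero.2 ha
  have hΘ0 : Θ ≠ 0 := pow_ne_zero _ hA0
  have hbound0 : 0 ≤ merrConst a S * (σ 0 (A * k) : ℝ) * totInvSum (S + 2 * Q') *
      ((Q' * r : ℝ) / K + 1 / Q') / Nat.totient r := by
    have := merrConst_nonneg a S
    have := totInvSum_nonneg (S + 2 * Q')
    positivity
  rw [e2fun_eq ha hr hrA hQ' hK hK1 hKS]
  unfold e1fun
  by_cases hkr : k.Coprime r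
  swap
  · -- `(k, r) > 1`: both terms vanish
    simp only [if_neg hkr, mul_zero, Finset.sum_const_zero, sub_zero, abs_zero]
    exact hbound0
  simp only [if_pos hkr]
  set W : ℕ → ℝ := fun g => phiWin r (A * k) ((K - 1) / (2 * (Q' * r * g))) ((K - 1) / (Q' * r * g)) with hW
  set WQ := phiWin r (A * k) Q' (2 * Q') with hWQ
  set P : ℕ → ℝ := fun w => pmodel a k w with hP
  set T := 200 * pAmp a * (σ 0 (A * k) : ℝ) * totInvSum (S + 2 * Q') *
    ((Q' * r : ℝ) / K + 1 / Q') / Nat.totient r with hT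
  have hT0 : 0 ≤ T := by
    have := totInvSum_nonneg (S + 2 * Q')
    rw [hT]; unfold pAmp; positivity
  -- restrict the `g`-sum to `dg ∣ Θ` (outside, the window is empty)
  have hrestrict : ∀ d ∈ A.divisors, ∑ g ∈ Θ.divisors, P (d * g) * W g =
      ∑ g ∈ Θ.divisors.filter (fun g => d * g ∣ Θ), P (d * g) * W g := by
    intro d hd
    rw [Finset.sum_filter]
    refine Finset.sum_congr rfl fun g hg => ?_
    by_cases h : d * g ∣ Θ
    · rw [if_pos h]
    · rw [if_neg h]
      have hV0 := div_eq_zero_of_not_dvd hKS (Nat.mul_pos hQ' hr) (K := K) hd hg h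
      simp only [hW, hV0]
      unfold phiWin
      simp
  -- `WQ = ∑_d μ(d) ∑_{g, dg ∣ Θ} P(dg) WQ`
  have hWQsum : WQ = ∑ d ∈ A.divisors, (μ d : ℝ) * ∑ g ∈ Θ.divisors.filter (fun g => d * g ∣ Θ),
      P (d * g) * WQ := by
    have := sum_moebius_sum_divisors_eq hA0 hΘ0 (by rw [hΘ, Nat.primeFactors_pow _ (by omega)])
      (fun w => P w * WQ)
    rw [this, hP]
    simp only [pmodel_one, one_mul]
  have hL : ∑ d ∈ A.divisors, (μ d : ℝ) * ∑ g ∈ Θ.divisors, P (d * g) * W g =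
      ∑ d ∈ A.divisors, (μ d : ℝ) * ∑ g ∈ Θ.divisors.filter (fun g => d * g ∣ Θ), P (d * g) * W g :=
    Finset.sum_congr rfl fun d hd => by rw [hrestrict d hd]
  have hdiff : ∑ d ∈ A.divisors, (μ d : ℝ) * ∑ g ∈ Θ.divisors, P (d * g) * W g - WQ =
      ∑ d ∈ A.divisors, (μ d : ℝ) * ∑ g ∈ Θ.divisors.filter (fun g => d * g ∣ Θ),
        P (d * g) * (W g - WQ) := by
    calc ∑ d ∈ A.divisors, (μ d : ℝ) * ∑ g ∈ Θ.divisors, P (d * g) * W g - WQ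
        = ∑ d ∈ A.divisors, (μ d : ℝ) * ∑ g ∈ Θ.divisors.filter (fun g => d * g ∣ Θ), P (d * g) * W g -
          ∑ d ∈ A.divisors, (μ d : ℝ) * ∑ g ∈ Θ.divisors.filter (fun g => d * g ∣ Θ), P (d * g) * WQ := by
          rw [hL, ← hWQsum]
      _ = ∑ d ∈ A.divisors, (μ d : ℝ) * ∑ g ∈ Θ.divisors.filter (fun g => d * g ∣ Θ),
            P (d * g) * (W g - WQ) := by
          rw [← Finset.sum_sub_distrib]
          refine Finset.sum_congr rfl fun d _ => ?_
          rw [← mul_sub, ← Finset.sum_sub_distrib]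
          congr 1
          exact Finset.sum_congr rfl fun g _ => by ring
  -- the LHS of the goal in terms of `W`, `P`
  have hgoal : ∑ d ∈ A.divisors, (μ d : ℝ) * ∑ g ∈ Θ.divisors,
      pmodel a k (d * g) * phiWin r (A * k) ((K - 1) / (2 * (Q' * r * g))) ((K - 1) / (Q' * r * g)) -
        phiWin r (A * k) Q' (2 * Q') =
      ∑ d ∈ A.divisors, (μ d : ℝ) * ∑ g ∈ Θ.divisors, P (d * g) * W g - WQ := by rfl
  rw [hgoal, hdiff]
  -- bound termwise
  calc |∑ d ∈ A.divisors, (μ d : ℝ) * ∑ g ∈ Θ.divisors.filter (fun g => d * g ∣ Θ), P (d * g) * (W g - WQ)|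
      ≤ ∑ d ∈ A.divisors, |(μ d : ℝ) * ∑ g ∈ Θ.divisors.filter (fun g => d * g ∣ Θ), P (d * g) * (W g - WQ)| :=
        Finset.abs_sum_le_sum_abs _ _
    _ ≤ ∑ d ∈ A.divisors, ∑ g ∈ Θ.divisors, T := by
        refine Finset.sum_le_sum fun d hd => ?_
        have hμ : |(μ d : ℝ)| ≤ 1 := by exact_mod_cast ArithmeticFunction.abs_moebius_le_one
        rw [abs_mul]
        calc |(μ d : ℝ)| * |∑ g ∈ Θ.divisors.filter (fun g => d * g ∣ Θ), P (d * g) * (W g - WQ)|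
            ≤ 1 * ∑ g ∈ Θ.divisors.filter (fun g => d * g ∣ Θ), |P (d * g) * (W g - WQ)| :=
              mul_le_mul hμ (Finset.abs_sum_le_sum_abs _ _) (abs_nonneg _) zero_le_one
          _ ≤ ∑ g ∈ Θ.divisors, |P (d * g) * (W g - WQ)| := by
              rw [one_mul]
              exact Finset.sum_le_sum_of_subset_of_nonneg (Finset.filter_subset _ _)
                (fun _ _ _ => abs_nonneg _)
          _ ≤ ∑ g ∈ Θ.divisors, T := by
              refine Finset.sum_le_sum fun g hg => ?_
              rw [abs_mul, abs_of_nonneg (pmodel_nonneg _ _ _)]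
              exact pmodel_mul_abs_phiWin_sub_le ha hr hQ' hK1 hKS hk hd hg
    _ = merrConst a S * (σ 0 (A * k) : ℝ) * totInvSum (S + 2 * Q') *
          ((Q' * r : ℝ) / K + 1 / Q') / Nat.totient r := by
        simp only [Finset.sum_const, nsmul_eq_mul]
        rw [← ArithmeticFunction.sigma_zero_apply, ← ArithmeticFunction.sigma_zero_apply, hT]
        unfold merrConst
        ring

/-! ### The expected terms of a block -/

/-- **`|B^{sw}(r,l) − B(r,l)| ≤ ∑_{m,n} merrConst τ(|a|lmn) Φ(S+2Q') (Q'r/(lmn−a) + 1/Q')/φ(r)`**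
for `a ≠ 0`, `r, Q' ≥ 1`, `(r, a) = (l, r) = 1`, ranges `SM, SN` of positive integers on which
`a < lmn` and `lmn − a ≤ S`: the expected term attached to the switched counts and the term `Δ*`
subtracts for the block `q ∈ (Q', 2Q']` agree up to a saving `Q'R/x + 1/Q'` (times `τ`, `Φ`, `1/φ(r)`).
[cite: BombieriFriedlanderIwaniecActa1986, §13 p. 241–242; §14 p. 246] -/
theorem abs_Bsw_sub_Borig_le {a : ℤ} (ha : a ≠ 0) (z : ℝ) {SM SN : Finset ℕ}
    (hSM : ∀ m ∈ SM, 0 < m) (hSN : ∀ n ∈ SN, 0 < n) {l r : ℕ} (hl : 0 < l)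
    (hr : 0 < r) (hrA : r.Coprime a.natAbs) (hlr : l.Coprime r) {Q' : ℕ} (hQ' : 0 < Q') {S : ℕ}
    (hpos : ∀ m ∈ SM, ∀ n ∈ SN, a < ((l * m * n : ℕ) : ℤ))
    (hS : ∀ m ∈ SM, ∀ n ∈ SN, ((l * m * n : ℕ) : ℤ) - a ≤ S) :
    |Bsw a z SM SN l r Q' S - Borig a z SM SN l r Q'| ≤
      ∑ m ∈ SM, ∑ n ∈ SN, merrConst a S * (σ 0 (a.natAbs * (l * m * n)) : ℝ) * totInvSum (S + 2 * Q') *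
        ((Q' * r : ℝ) / (((l * m * n : ℕ) : ℝ) - a) + 1 / Q') / Nat.totient r := by
  rw [Bsw_eq, Borig_eq a z SM SN hlr, ← Finset.sum_sub_distrib]
  refine (Finset.abs_sum_le_sum_abs _ _).trans (Finset.sum_le_sum fun m hm => ?_)
  rw [← Finset.sum_sub_distrib]
  refine (Finset.abs_sum_le_sum_abs _ _).trans (Finset.sum_le_sum fun n hn => ?_)
  rw [← mul_sub, abs_mul]
  -- `K = lmn − a ≥ 1`
  have hKpos : 0 < ((l * m * n : ℕ) : ℤ) - a := by linarith [hpos m hm n hn]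
  obtain ⟨K, hKeq⟩ := Int.eq_ofNat_of_zero_le hKpos.le
  have hK1 : 1 ≤ K := by
    have : (1 : ℤ) ≤ (K : ℤ) := by rw [← hKeq]; omega
    exact_mod_cast this
  have hKS : K ≤ S := by
    have : (K : ℤ) ≤ (S : ℤ) := by rw [← hKeq]; exact hS m hm n hn
    exact_mod_cast this
  have hk0 : l * m * n ≠ 0 := (Nat.mul_pos (Nat.mul_pos hl (hSM m hm)) (hSN n hn)).ne'
  have hρ : |roughIndicator z m * roughIndicator z n| ≤ 1 := by
    rw [abs_mul]
    exact mul_le_one₀ (abs_roughIndicator_le_one z m) (abs_nonneg _) (abs_roughIndicator_le_one z n)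
  have hmain := abs_e2fun_sub_e1fun_le ha hr hrA hQ' hKeq hK1 hKS hk0
  have hcast : (((l * m * n : ℕ) : ℝ) - a) = (K : ℝ) := by
    have := congrArg (fun x : ℤ => (x : ℝ)) hKeq
    push_cast at this ⊢
    linarith
  rw [hcast]
  calc |roughIndicator z m * roughIndicator z n| * |e2fun a r Q' S (l * m * n) - e1fun a r Q' (l * m * n)|
      ≤ 1 * (merrConst a S * (σ 0 (a.natAbs * (l * m * n)) : ℝ) * totInvSum (S + 2 * Q') *
          ((Q' * r : ℝ) / K + 1 / Q') / Nat.totient r) :=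
        mul_le_mul hρ hmain (abs_nonneg _) zero_le_one
    _ = _ := one_mul _

end BFI

end Literature.NumberTheory.Sieve
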